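/-
Copyright (c) 2026 the pub-hodgecm-mathlib formalisation cell (harness21).  Prover seat hodgecm-mathlib-K2E1-p15 (g0), Track B ∕ K2-LIT «5Res», h413 = `stmt-HodgeConjecture-24833`,
line `K2_E1_TraceFormulaBeta`, route of record `HCCMUnconditional`; dealer K2E1-plan (g7) deal 13:48:23Z «the density lemma»: the C7 ∕ W-b pseudo-Eisenstein bricks with CONTINUOUS
radial profiles have the same closed span as those with SMOOTH profiles.
-/
import Summits.HodgeConjecture.HodgeConjecture.Theorems.K2E1EisensteinNiceClassCMTwo    -- ★ p860388 (this seat): `memLp_quotFun_eisensteinSeriesU_of_nice` (+ ★ F3d-γ `exists_const_norm_eisensteinSeriesU_le_cm`, `eisensteinSeriesU_eq_finset_sum_of_band`, `norm_toLp_quotFun_le_of_forall_norm_le`)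
import Summits.HodgeConjecture.HodgeConjecture.Theorems.K2E1ChiMaassSelbergCMTwo        -- ★ (K2E1-p14): `IsChiSection.arithmeticBorel_mul` (+ ★ `chiSectionSpace`)
import Summits.HodgeConjecture.HodgeConjecture.Theorems.K2E1ChiSectionSpaceU2Defs      -- ★ `chiSectionSpace`
import Mathlib.Analysis.Calculus.BumpFunction.SmoothApprox
import HarnessLib

/-!
# K2·E1 — `K2E1PseudoEisensteinSmoothBricksDenseU2`: THE PSEUDO-EISENSTEIN BRICKS `[θ_{f,φ}]` WITH CONTINUOUS PROFILES `f ∈ C_c((0,∞))` AND WITH SMOOTH PROFILES `f ∈ C^∞_c((0,∞))`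
# SPAN THE SAME CLOSED SUBSPACE OF `L²(𝔛)` (`U(1,1)_{L∕L⁺}`; the density lemma of the C7 road)

Track B ∕ K2-LIT, crux h413 = `stmt-HodgeConjecture-24833`; cell `hodgecm-mathlib`, squad K2, ENGINE E1; dealer K2E1-plan (g7) 13:48:23Z.  THEOREMS ONLY (no `def`, no `instance`, no notation,
no named-fact hypothesis, no `sorry`); lane `--kind proof --supports stmt-HodgeConjecture-24833 --as helper` (count-neutral).  Closes no socket.

WHAT.  Generators in ★ C7 ∕ W-b bytes: `[θ_{f,φ}] = (hv : MemLp (quotFun (E (g ↦ f(H g)·φ g))) 2 μ).toLp` with `f : ℝ → ℂ` continuous, compact support `⊆ (0,∞)`, `φ ∈ chiSectionSpace χ K′ 1`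
continuous.  (§1) A continuous `f` is uniformly `ε`-close to a smooth `g`, both supported in one band `[x₀∕2, x₁ + x₀∕2]`; (§2) for band-supported left-`B(F)`-invariant profiles the class
depends Lipschitz-continuously on the sup norm (`‖[θ_u] − [θ_{u′}]‖ ≤ μ(𝔛)^{½}·C_a·sup‖u − u′‖`, ★ F3d-γ uniform count) — so (§3) every continuous-profile brick is a limit of smooth-profile
bricks, and the two closed spans coincide.  The `χ`-sections need only be BOUNDED (letter `hχb`: true for unitary `χ` by Iwasawa; K2E1-p10's ED).
* §1 **`exists_band_forall_smooth_approx`** · §2 **`norm_toLp_sub_toLp_le_of_band`** · §3 **`topologicalClosure_span_continuous_eq_smooth`**.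

HONEST LABEL: HC_CM is proved only modulo the 7 printed citations (2 remaining named inputs: hLiu418 = `stmt-HodgeConjecture-24832`, h413 = `stmt-HodgeConjecture-24833`) until rung 0
closes; this file asserts no named fact and closes no socket.

## References
* [MoeglinWaldspurger1995] C. Mœglin, J.-L. Waldspurger, *Spectral decomposition and Eisenstein series* (1995), II.1.2–II.1.3, I.2.13.
* [Folland1999] G. B. Folland, *Real Analysis*, 2nd ed. (1999), Prop. 8.17 (mollification).
-/

set_option autoImplicit false
set_option linter.dupNamespace false  -- the mandated namespace repeats the summit's segment (`HodgeConjecture.HodgeConjecture`)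

noncomputable section

open MeasureTheory Measure Set Filter Topology NumberField Metric
open scoped NNReal ENNReal
open Literature.NumberTheory.Automorphic Literature.NumberTheory.Automorphic.UnitaryGroup AdelicGroupData
open Literature.NumberTheory.GaloisRepresentations (HeckeCharacter)
open Summit.HodgeConjecture.HodgeConjecture.Cruxes.H413.K2E1BorelEisensteinU
open Summit.HodgeConjecture.HodgeConjecture.Cruxes.H413.K2E1CharacterEisensteinU2Defs
open Summit.HodgeConjecture.HodgeConjecture.Cruxes.H413.K2E1ChiSectionSpaceU2Defs
open Summit.HodgeConjecture.HodgeConjecture.Cruxes.H413.K2E1EisensteinSupNormBandBoundCMTwo (exists_const_norm_eisensteinSeriesU_le_cm eisensteinSeriesU_eq_finset_sum_of_band norm_toLp_quotFun_le_of_forall_norm_le)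
open Summit.HodgeConjecture.HodgeConjecture.Cruxes.H413.K2E1EisensteinNiceClassCMTwo (memLp_quotFun_eisensteinSeriesU_of_nice)

namespace Summit.HodgeConjecture.HodgeConjecture.Cruxes.H413.K2E1PseudoEisensteinSmoothBricksDenseU2

/-! ## §1 Smooth compactly supported approximation inside `(0, ∞)` -/

/-- **SMOOTH COMPACTLY SUPPORTED APPROXIMATION INSIDE `(0, ∞)`**: a continuous `f : ℝ → ℂ` with compact support in `(0,∞)` is uniformly `ε`-close to a smooth `g` with compact
support in `(0,∞)`, both supported in ONE band `[x₀∕2, x₁ + x₀∕2]` (Mathlib `UniformContinuous.exists_contDiff_dist_le` + a `ContDiffBump` cut-off equal to `1` on the support of `f`). [folklore] -/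
theorem exists_band_forall_smooth_approx {f : ℝ → ℂ} (hf : Continuous f) (hfs : HasCompactSupport f) (hf0 : tsupport f ⊆ Ioi 0) :
    ∃ a b : ℝ, 0 < a ∧ (∀ x, f x ≠ 0 → a ≤ x ∧ x ≤ b) ∧ ∀ ε : ℝ, 0 < ε →
      ∃ g : ℝ → ℂ, ContDiff ℝ (⊤ : ℕ∞) g ∧ HasCompactSupport g ∧ tsupport g ⊆ Ioi 0 ∧ (∀ x, g x ≠ 0 → a ≤ x ∧ x ≤ b) ∧ ∀ x, ‖g x - f x‖ ≤ ε := by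
  classical
  rcases (tsupport f).eq_empty_or_nonempty with hemp | hne
  · -- `f = 0`
    have hf0' : ∀ x, f x = 0 := fun x => by
      by_contra h
      have : x ∈ tsupport f := subset_tsupport _ h
      rw [hemp] at this; exact this
    refine ⟨1, 1, one_pos, fun x hx => absurd (hf0' x) hx, fun ε hε => ⟨0, contDiff_const, HasCompactSupport.zero, by simp, fun x hx => absurd rfl hx, fun x => ?_⟩⟩
    simp [hf0' x, hε.le]
  · -- extremes of the support
    obtain ⟨x₀, hx₀, hmin⟩ := hfs.exists_isMinOn hne continuous_id.continuousOn
    obtain ⟨x₁, hx₁, hmax⟩ := hfs.exists_isMaxOn hne continuous_id.continuousOn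
    have ha0 : 0 < x₀ := hf0 hx₀
    have hsupp : ∀ x, f x ≠ 0 → x₀ ≤ x ∧ x ≤ x₁ := fun x hx =>
      ⟨hmin (subset_tsupport _ hx), hmax (subset_tsupport _ hx)⟩
    have hx01 : x₀ ≤ x₁ := hmin hx₁
    have huc : UniformContinuous f := hf.uniformContinuous_of_tendsto_cocompact hfs.is_zero_at_infty
    -- a smooth cutoff equal to `1` on `[x₀, x₁]`, supported in `(x₀/2, x₁ + x₀/2)`
    set c : ℝ := (x₀ + x₁) / 2 with hc
    let χ : ContDiffBump c := ⟨(x₁ - x₀) / 2 + x₀ / 4, (x₁ - x₀) / 2 + x₀ / 2, by linarith, by linarith⟩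
    refine ⟨x₀ / 2, x₁ + x₀ / 2, by linarith, fun x hx => ?_, fun ε hε => ?_⟩
    · obtain ⟨h1, h2⟩ := hsupp x hx
      constructor <;> linarith
    obtain ⟨g₀, hg₀, hg₀ε⟩ := huc.exists_contDiff_dist_le hε
    refine ⟨fun x => (χ x : ℂ) * g₀ x, ?_, ?_, ?_, fun x hx => ?_, fun x => ?_⟩
    · exact (Complex.ofRealCLM.contDiff.comp χ.contDiff).mul hg₀
    · exact (χ.hasCompactSupport.comp_left (g := fun r : ℝ => (r : ℂ)) Complex.ofReal_zero).mul_right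
    · intro x hx
      have hx' : x ∈ tsupport (fun x => (χ x : ℂ)) := tsupport_mul_subset_left hx
      have h2 : tsupport (fun x => (χ x : ℂ)) ⊆ tsupport χ := by
        refine closure_mono fun y hy => ?_
        simp only [Function.mem_support, ne_eq, Complex.ofReal_eq_zero] at hy ⊢
        exact hy
      have h3 := h2 hx'
      rw [χ.tsupport_eq, mem_closedBall, Real.dist_eq] at h3
      rw [mem_Ioi]
      have := abs_le.1 h3
      have e : (x₁ - x₀) / 2 + x₀ / 2 = χ.rOut := rfl
      linarith [e]
    · have hχ : χ x ≠ 0 := by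
        intro h0; apply hx; simp [h0]
      have : x ∈ Function.support (χ : ℝ → ℝ) := hχ
      rw [χ.support_eq, mem_ball, Real.dist_eq] at this
      have := abs_lt.1 this
      have e : (x₁ - x₀) / 2 + x₀ / 2 = χ.rOut := rfl
      constructor <;> linarith [e]
    · by_cases hfx : f x = 0
      · show ‖(χ x : ℂ) * g₀ x - f x‖ ≤ ε
        rw [hfx, sub_zero, norm_mul, Complex.norm_real, Real.norm_of_nonneg χ.nonneg]
        have h1 : ‖g₀ x‖ ≤ ε := by
          have := (hg₀ε x).le
          rwa [dist_eq_norm, hfx, sub_zero] at this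
        calc χ x * ‖g₀ x‖ ≤ 1 * ‖g₀ x‖ := mul_le_mul_of_nonneg_right χ.le_one (norm_nonneg _)
          _ ≤ ε := by rw [one_mul]; exact h1
      · have hx1 : χ x = 1 := by
          refine χ.one_of_mem_closedBall ?_
          rw [mem_closedBall, Real.dist_eq, abs_le]
          obtain ⟨h1, h2⟩ := hsupp x hfx
          have e : (x₁ - x₀) / 2 + x₀ / 4 = χ.rIn := rfl
          constructor <;> linarith [e]
        show ‖(χ x : ℂ) * g₀ x - f x‖ ≤ ε
        rw [hx1, Complex.ofReal_one, one_mul, ← dist_eq_norm]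
        exact (hg₀ε x).le

/-! ## §2 The brick class depends Lipschitz-continuously on the band profile -/

section CM

variable (L : Type) [Field L] [NumberField L] [IsCMField L]
  [MeasurableSpace (quasiSplit (↥(maximalRealSubfield L)) L (IsCMField.complexConj L) 2).Adelic] [BorelSpace (quasiSplit (↥(maximalRealSubfield L)) L (IsCMField.complexConj L) 2).Adelic]

omit [MeasurableSpace (quasiSplit (↥(maximalRealSubfield L)) L (IsCMField.complexConj L) 2).Adelic] [BorelSpace (quasiSplit (↥(maximalRealSubfield L)) L (IsCMField.complexConj L) 2).Adelic] in
/-- **`‖[θ_u] − [θ_{u′}]‖_{L²} ≤ μ(𝔛)^½·C_a·ε`** for two left-`B(F)`-invariant profiles `u, u′` vanishing below the height `a > 0` with `‖u − u′‖ ≤ ε` pointwise (the Eisenstein sums are the SAME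
finite sums ★ `eisensteinSeriesU_eq_finset_sum_of_band`, so `θ_u − θ_{u′} = θ_{u−u′}` pointwise; ★ F3d-γ `exists_const_norm_eisensteinSeriesU_le_cm`; ★ `norm_toLp_quotFun_le_of_forall_norm_le`).
[cite: MoeglinWaldspurger1995, II.1.3, I.2.13] -/
theorem norm_toLp_sub_toLp_le_of_band (μ : Measure (quasiSplit (↥(maximalRealSubfield L)) L (IsCMField.complexConj L) 2).automorphicQuotient) [IsFiniteMeasure μ] {a : ℝ≥0} (ha : 0 < a) :
    ∃ C : ℝ, 0 ≤ C ∧ ∀ (u u' : (quasiSplit (↥(maximalRealSubfield L)) L (IsCMField.complexConj L) 2).Adelic → ℂ)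
      (_ : ∀ b ∈ arithmeticBorel (↥(maximalRealSubfield L)) L (IsCMField.complexConj L) 2, ∀ x, u ((b : (quasiSplit (↥(maximalRealSubfield L)) L (IsCMField.complexConj L) 2).Adelic) * x) = u x)
      (_ : ∀ b ∈ arithmeticBorel (↥(maximalRealSubfield L)) L (IsCMField.complexConj L) 2, ∀ x, u' ((b : (quasiSplit (↥(maximalRealSubfield L)) L (IsCMField.complexConj L) 2).Adelic) * x) = u' x)
      (_ : ∀ g, borelHeight g ≤ a → u g = 0) (_ : ∀ g, borelHeight g ≤ a → u' g = 0) (ε : ℝ) (_ : ∀ g, ‖u g - u' g‖ ≤ ε)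
      (hv : MemLp ((quasiSplit (↥(maximalRealSubfield L)) L (IsCMField.complexConj L) 2).quotFun (eisensteinSeriesU u)) 2 μ) (hv' : MemLp ((quasiSplit (↥(maximalRealSubfield L)) L (IsCMField.complexConj L) 2).quotFun (eisensteinSeriesU u')) 2 μ),
        ‖hv.toLp _ - hv'.toLp _‖ ≤ (measureUnivNNReal μ : ℝ) ^ (2 : ℝ)⁻¹ * (C * ε) := by
  obtain ⟨C, hC0, hC⟩ := exists_const_norm_eisensteinSeriesU_le_cm L ha
  refine ⟨C, hC0, fun u u' huB hu'B hua hu'a ε hε hv hv' => ?_⟩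
  have hε0 : 0 ≤ ε := (norm_nonneg _).trans (hε 1)
  -- `θ_u − θ_{u′} = θ_{u − u′}` pointwise (same finite sums)
  have hdB : ∀ b ∈ arithmeticBorel (↥(maximalRealSubfield L)) L (IsCMField.complexConj L) 2, ∀ x, (u - u') ((b : (quasiSplit (↥(maximalRealSubfield L)) L (IsCMField.complexConj L) 2).Adelic) * x) = (u - u') x :=
    fun b hb x => by simp only [Pi.sub_apply, huB b hb x, hu'B b hb x]
  have hda : ∀ g, borelHeight g ≤ a → (u - u') g = 0 := fun g hg => by simp only [Pi.sub_apply, hua g hg, hu'a g hg, sub_self]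
  have hsub : ∀ g, eisensteinSeriesU u g - eisensteinSeriesU u' g = eisensteinSeriesU (u - u') g := fun g => by
    rw [eisensteinSeriesU_eq_finset_sum_of_band huB ha hua g, eisensteinSeriesU_eq_finset_sum_of_band hu'B ha hu'a g,
      eisensteinSeriesU_eq_finset_sum_of_band hdB ha hda g, ← Finset.sum_sub_distrib]
    rfl
  have hvd : MemLp ((quasiSplit (↥(maximalRealSubfield L)) L (IsCMField.complexConj L) 2).quotFun (eisensteinSeriesU (u - u'))) 2 μ := by
    have : (quasiSplit (↥(maximalRealSubfield L)) L (IsCMField.complexConj L) 2).quotFun (eisensteinSeriesU (u - u')) = (quasiSplit (↥(maximalRealSubfield L)) L (IsCMField.complexConj L) 2).quotFun (eisensteinSeriesU u) - (quasiSplit (↥(maximalRealSubfield L)) L (IsCMField.complexConj L) 2).quotFun (eisensteinSeriesU u') := by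
      funext x
      show eisensteinSeriesU (u - u') _ = eisensteinSeriesU u _ - eisensteinSeriesU u' _
      rw [hsub]
    rw [this]; exact hv.sub hv'
  have heq : hv.toLp _ - hv'.toLp _ = hvd.toLp _ := by
    rw [← MemLp.toLp_sub]
    congr 1
    funext x
    show eisensteinSeriesU u _ - eisensteinSeriesU u' _ = eisensteinSeriesU (u - u') _
    rw [hsub]
  rw [heq]
  exact norm_toLp_quotFun_le_of_forall_norm_le _ μ (mul_nonneg hC0 hε0) (fun g => hC _ hdB hda ε (fun x => hε x) g) hvd

/-! ## §3 The closed spans coincide -/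

/-- **THE BRICKS WITH CONTINUOUS PROFILES AND WITH SMOOTH PROFILES HAVE THE SAME CLOSED SPAN IN `L²(𝔛)`** (module docstring): for every Hecke character `χ`, every level subgroup `K′`
and every finite measure `μ` on `𝔛`, provided the continuous `χ`-sections of level `K′` are bounded (letter `hχb`, unitary `χ`).  `⊇` is trivial; `⊆`: a continuous-profile brick
`[θ_{f,φ}]` is the `L²`-limit of the smooth-profile bricks `[θ_{g_n,φ}]` of §1 (`‖f − g_n‖_∞ ≤ 1∕(n+1)`, common band), by §2. [cite: MoeglinWaldspurger1995, II.1.2–II.1.3] [cite: Folland1999, Prop. 8.17] -/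
theorem topologicalClosure_span_continuous_eq_smooth (μ : Measure (quasiSplit (↥(maximalRealSubfield L)) L (IsCMField.complexConj L) 2).automorphicQuotient) [IsFiniteMeasure μ]
    (χ : HeckeCharacter L) (K' : Subgroup (quasiSplit (↥(maximalRealSubfield L)) L (IsCMField.complexConj L) 2).Adelic)
    (hχb : ∀ φ : (quasiSplit (↥(maximalRealSubfield L)) L (IsCMField.complexConj L) 2).Adelic → ℂ, φ ∈ chiSectionSpace χ K' 1 → Continuous φ → ∃ M : ℝ, ∀ g, ‖φ g‖ ≤ M) :
    (Submodule.span ℂ {v : Lp ℂ 2 μ |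
      ∃ (f : ℝ → ℂ) (_ : Continuous f) (_ : HasCompactSupport f) (_ : tsupport f ⊆ Ioi 0)
        (φ : (quasiSplit (↥(maximalRealSubfield L)) L (IsCMField.complexConj L) 2).Adelic → ℂ) (_ : φ ∈ chiSectionSpace χ K' 1) (_ : Continuous φ)
        (hv : MemLp ((quasiSplit (↥(maximalRealSubfield L)) L (IsCMField.complexConj L) 2).quotFun (eisensteinSeriesU (fun g => f (borelHeight g) * φ g))) 2 μ), v = hv.toLp _}).topologicalClosure =
    (Submodule.span ℂ {v : Lp ℂ 2 μ |
      ∃ (f : ℝ → ℂ) (_ : ContDiff ℝ (⊤ : ℕ∞) f) (_ : Continuous f) (_ : HasCompactSupport f) (_ : tsupport f ⊆ Ioi 0)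
        (φ : (quasiSplit (↥(maximalRealSubfield L)) L (IsCMField.complexConj L) 2).Adelic → ℂ) (_ : φ ∈ chiSectionSpace χ K' 1) (_ : Continuous φ)
        (hv : MemLp ((quasiSplit (↥(maximalRealSubfield L)) L (IsCMField.complexConj L) 2).quotFun (eisensteinSeriesU (fun g => f (borelHeight g) * φ g))) 2 μ), v = hv.toLp _}).topologicalClosure := by
  classical
  apply le_antisymm
  · -- `⊆`: every continuous-profile brick is a limit of smooth-profile bricks
    refine (Submodule.topologicalClosure_minimal _ ?_ (Submodule.isClosed_topologicalClosure _))
    refine Submodule.span_le.2 ?_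
    rintro v ⟨f, hf, hfs, hf0, φ, hφV, hφc, hv, rfl⟩
    obtain ⟨Mφ, hMφ⟩ := hχb φ hφV hφc
    have hφB : ∀ b ∈ arithmeticBorel (↥(maximalRealSubfield L)) L (IsCMField.complexConj L) 2, ∀ x, φ ((b : (quasiSplit (↥(maximalRealSubfield L)) L (IsCMField.complexConj L) 2).Adelic) * x) = φ x :=
      hφV.1.arithmeticBorel_mul
    -- the band of `f` and the smooth approximants at precision `1∕(n+1)`
    obtain ⟨a, b, ha, hfa, happ⟩ := exists_band_forall_smooth_approx hf hfs hf0
    choose g hg hgs hg0 hga hgε using fun n : ℕ => happ (1 / ((n : ℝ) + 1)) (by positivity)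
    obtain ⟨Mf, hMf⟩ := hf.bounded_above_of_compact_support hfs
    -- the profiles on the group
    set u : (quasiSplit (↥(maximalRealSubfield L)) L (IsCMField.complexConj L) 2).Adelic → ℂ := fun x => f (borelHeight x) * φ x with hu
    set w : ℕ → (quasiSplit (↥(maximalRealSubfield L)) L (IsCMField.complexConj L) 2).Adelic → ℂ := fun n x => g n (borelHeight x) * φ x with hw
    have hH : ∀ β' ∈ arithmeticBorel (↥(maximalRealSubfield L)) L (IsCMField.complexConj L) 2, ∀ x : (quasiSplit (↥(maximalRealSubfield L)) L (IsCMField.complexConj L) 2).Adelic,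
        borelHeight ((β' : (quasiSplit (↥(maximalRealSubfield L)) L (IsCMField.complexConj L) 2).Adelic) * x) = borelHeight x := fun β' hβ' x => K2E1TruncatedEisensteinExplicit.borelHeight_arithmeticBorel_mul hβ' x
    have huB : ∀ β' ∈ arithmeticBorel (↥(maximalRealSubfield L)) L (IsCMField.complexConj L) 2, ∀ x, u ((β' : (quasiSplit (↥(maximalRealSubfield L)) L (IsCMField.complexConj L) 2).Adelic) * x) = u x := fun β' hβ' x => by
      simp only [hu, hH β' hβ' x, hφB β' hβ' x]
    have hwB : ∀ n, ∀ β' ∈ arithmeticBorel (↥(maximalRealSubfield L)) L (IsCMField.complexConj L) 2, ∀ x, w n ((β' : (quasiSplit (↥(maximalRealSubfield L)) L (IsCMField.complexConj L) 2).Adelic) * x) = w n x := fun n β' hβ' x => by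
      simp only [hw, hH β' hβ' x, hφB β' hβ' x]
    -- the common height cut-off `a₀ = a∕2`
    set a₀ : ℝ≥0 := (a / 2).toNNReal with ha₀
    have ha₀c : ((a₀ : ℝ≥0) : ℝ) = a / 2 := by rw [ha₀]; exact Real.coe_toNNReal _ (by positivity)
    have ha₀0 : 0 < a₀ := by rw [← NNReal.coe_pos, ha₀c]; positivity
    set b₀ : ℝ≥0 := (max b 0).toNNReal with hb₀
    have hb₀c : ((b₀ : ℝ≥0) : ℝ) = max b 0 := by rw [hb₀]; exact Real.coe_toNNReal _ (le_max_right _ _)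
    have hbelow : ∀ (p : ℝ → ℂ), (∀ y, p y ≠ 0 → a ≤ y ∧ y ≤ b) → ∀ x : (quasiSplit (↥(maximalRealSubfield L)) L (IsCMField.complexConj L) 2).Adelic, borelHeight x ≤ a₀ → p (borelHeight x) * φ x = 0 := by
      intro p hp x hx
      by_cases h0 : p (borelHeight x) = 0
      · rw [h0, zero_mul]
      · exfalso
        have h1 := (hp _ h0).1
        have h2 : ((borelHeight x : ℝ≥0) : ℝ) ≤ a / 2 := by rw [← ha₀c]; exact_mod_cast hx
        linarith
    have hua : ∀ x : (quasiSplit (↥(maximalRealSubfield L)) L (IsCMField.complexConj L) 2).Adelic, borelHeight x ≤ a₀ → u x = 0 := hbelow f hfa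
    have hwa : ∀ n, ∀ x : (quasiSplit (↥(maximalRealSubfield L)) L (IsCMField.complexConj L) 2).Adelic, borelHeight x ≤ a₀ → w n x = 0 := fun n => hbelow (g n) (hga n)
    -- the classes of the approximants are smooth-profile bricks
    have hband : ∀ n, ∀ x : (quasiSplit (↥(maximalRealSubfield L)) L (IsCMField.complexConj L) 2).Adelic, w n x ≠ 0 → a₀ ≤ borelHeight x ∧ borelHeight x ≤ b₀ := by
      intro n x hx
      have hg' : g n (borelHeight x) ≠ 0 := fun h => hx (by simp only [hw, h, zero_mul])
      obtain ⟨h1, h2⟩ := hga n _ hg'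
      refine ⟨?_, ?_⟩
      · rw [← NNReal.coe_le_coe, ha₀c]; linarith
      · rw [← NNReal.coe_le_coe, hb₀c]; exact h2.trans (le_max_left _ _)
    have hwM : ∀ n x, ‖w n x‖ ≤ (Mf + 1) * Mφ := by
      intro n x
      rw [hw]; simp only [norm_mul]
      refine mul_le_mul ?_ (hMφ x) (norm_nonneg _) (by linarith [(norm_nonneg _).trans (hMf 1)])
      calc ‖g n (borelHeight x)‖ = ‖(g n (borelHeight x) - f (borelHeight x)) + f (borelHeight x)‖ := by rw [sub_add_cancel]
        _ ≤ ‖g n (borelHeight x) - f (borelHeight x)‖ + ‖f (borelHeight x)‖ := norm_add_le _ _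
        _ ≤ 1 / ((n : ℝ) + 1) + Mf := add_le_add (hgε n _) (hMf _)
        _ ≤ 1 + Mf := by
            refine add_le_add ?_ le_rfl
            rw [div_le_one (by positivity)]; linarith [n.cast_nonneg (α := ℝ)]
        _ = Mf + 1 := add_comm _ _
    have hwc : ∀ n, Continuous (w n) := fun n => ((hg n).continuous.comp (NNReal.continuous_coe.comp continuous_borelHeight)).mul hφc
    have hvw : ∀ n, MemLp ((quasiSplit (↥(maximalRealSubfield L)) L (IsCMField.complexConj L) 2).quotFun (eisensteinSeriesU (w n))) 2 μ := fun n =>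
      memLp_quotFun_eisensteinSeriesU_of_nice L μ 2 (hwc n) (hwB n) (hwM n) ha₀0 (hband n)
    have hmem : ∀ n, (hvw n).toLp _ ∈ Submodule.span ℂ {v : Lp ℂ 2 μ |
        ∃ (f : ℝ → ℂ) (_ : ContDiff ℝ (⊤ : ℕ∞) f) (_ : Continuous f) (_ : HasCompactSupport f) (_ : tsupport f ⊆ Ioi 0)
          (φ : (quasiSplit (↥(maximalRealSubfield L)) L (IsCMField.complexConj L) 2).Adelic → ℂ) (_ : φ ∈ chiSectionSpace χ K' 1) (_ : Continuous φ)
          (hv : MemLp ((quasiSplit (↥(maximalRealSubfield L)) L (IsCMField.complexConj L) 2).quotFun (eisensteinSeriesU (fun g => f (borelHeight g) * φ g))) 2 μ), v = hv.toLp _} :=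
      fun n => Submodule.subset_span ⟨g n, hg n, (hg n).continuous, hgs n, hg0 n, φ, hφV, hφc, hvw n, rfl⟩
    -- the `L²` estimate and the limit
    obtain ⟨C, hC0, hC⟩ := norm_toLp_sub_toLp_le_of_band L μ ha₀0
    have hdist : ∀ n, ‖hv.toLp _ - (hvw n).toLp _‖ ≤ (measureUnivNNReal μ : ℝ) ^ (2 : ℝ)⁻¹ * (C * (Mφ * (1 / ((n : ℝ) + 1)))) := by
      intro n
      refine hC u (w n) huB (hwB n) hua (hwa n) _ (fun x => ?_) hv (hvw n)
      rw [hu, hw]; simp only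
      rw [← sub_mul, norm_mul, mul_comm]
      exact mul_le_mul (hMφ x) (by rw [norm_sub_rev]; exact hgε n _) (norm_nonneg _) ((norm_nonneg _).trans (hMφ x))
    have hlim : Tendsto (fun n => (hvw n).toLp _) atTop (𝓝 (hv.toLp _)) := by
      rw [tendsto_iff_norm_sub_tendsto_zero]
      have h0 : Tendsto (fun n : ℕ => (measureUnivNNReal μ : ℝ) ^ (2 : ℝ)⁻¹ * (C * (Mφ * (1 / ((n : ℝ) + 1))))) atTop (𝓝 0) := by
        have := ((tendsto_one_div_add_atTop_nhds_zero_nat.const_mul Mφ).const_mul C).const_mul ((measureUnivNNReal μ : ℝ) ^ (2 : ℝ)⁻¹)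
        simpa using this
      refine squeeze_zero (fun n => norm_nonneg _) (fun n => ?_) h0
      rw [norm_sub_rev]; exact hdist n
    rw [Submodule.topologicalClosure_coe]
    exact mem_closure_of_tendsto hlim (Eventually.of_forall hmem)
  · -- `⊇`: smooth profiles are continuous profiles
    refine Submodule.topologicalClosure_mono (Submodule.span_mono ?_)
    rintro v ⟨f, -, hf, hfs, hf0, φ, hφV, hφc, hv, rfl⟩
    exact ⟨f, hf, hfs, hf0, φ, hφV, hφc, hv, rfl⟩

end CM

end Summit.HodgeConjecture.HodgeConjecture.Cruxes.H413.K2E1PseudoEisensteinSmoothBricksDenseU2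

end
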